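import Summits.HodgeConjecture.CorCM.CMAlgebraDegreeLeEightFamilies
import Summits.HodgeConjecture.CorCM.SimpleCMSurfaceTimesThreefoldHodge
import Summits.HodgeConjecture.CorCM.CurvesTimesTwoSimpleCMSurfacesHodge
import HarnessLib

/-!
# Simple, pairwise non-isogenous CM abelian varieties of total dimension `≤ 5`: the product is stably nondegenerate
# iff no curve field embeds in the field of a threefold or fourfold factor and a fourfold factor is nondegenerate

COR-CM (cell `pub-hodgecm2`, binder seat `b16` gen 38, count-neutral claim CM5-CLASSIF, file F5; theorems only, no
definition, no named fact).  NEW as stated (an assembly of tree theorems), hence under `Summits/`.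

[MoonenZarhin1999LowDim, Thm. (0.2)] (dimension `5`): apart from a simple factor of dimension `4` and the cases
(e) `X ∼ X₁² × X₂`, (f) `X ∼ X₀ × X₁ × X₂`, (g) `X ∼ X₁ × X₂` (`X₁` a CM elliptic curve with `k ↪ End⁰(X₂)`, `X₂` simple
of dimension `3`, resp. `4`), «`Hg(X) = ∏ Hg(Y_j^{m_j})` … `B•(Xⁿ) = D•(Xⁿ)` for every `n ≥ 1`».  CM-TYPE LEVEL, the
dimension-`5` sequel of `CorCM/CMAlgebraDegreeLeEightFamilies` (total dimension `≤ 4`): for SIMPLE, PAIRWISE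
NON-ISOGENOUS complex abelian varieties `A_i` with complex multiplication (realisations of CM types `(K_i; Φ_i)` on `H¹`)
of total dimension `Σ_i dim A_i ≤ 5`:

* **`isNondegenerateFamily_iff_of_isSimple_of_sum_dim_le_five`** — the family is NONDEGENERATE iff
  (¬a⁺) no imaginary quadratic `K_a` (`dim A_a = 1`) embeds in the field of a slot of dimension `3` OR `4`, and
  (¬b) the type of a fourfold member is nondegenerate.  New degree multisets beyond file 1: `{10}` (Yanai, prime `5`),
  `{8,2}` (seat b16 gen 37's single-big-slot criterion: MZ99 (g)), `{6,4}` (ALWAYS nondegenerate: seat b16's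
  `isNondegenerateFamily_simpleSurface_simpleThreefold`, file SURF-T3), `{6,2,2}` (MZ99 (f)), `{4,4,2}` (curves × two
  simple surfaces: `isNondegenerateFamily_curves_simpleSurfaces`, file F4), `{4,2,2,2}`, `{2⁵}`;
* `hodgeClassSpan_prod_eq_divisorClassesSpan_of_sum_dim_le_five`, **`hodgeConjectureFor_prod_of_sum_dim_le_five`** —
  under (¬a⁺) ∧ (¬b): `B• = D•` and the Hodge conjecture on every `⨁_{j<N} A_{π j}`, UNCONDITIONALLY;
  **`forall_prod_hodgeClassSpan_eq_iff_of_sum_dim_le_five`**, **`exists_exceptional_prod_iff_of_sum_dim_le_five`** —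
  `B• = D•` on all products iff (¬a⁺) ∧ (¬b); an exotic class on some product iff (a⁺) ∨ (b).

## References

* [MoonenZarhin1999LowDim] B. Moonen, Yu. Zarhin, *Hodge classes on abelian varieties of low dimension*, Math. Ann.
  315 (1999) 711–733, Thm. (0.2) (e)–(g), (1)–(4); §5.
* [Gordon1999HodgeAVSurvey] B. B. Gordon, *A survey of the Hodge conjecture for abelian varieties*, §3 Theorem, 7.4–7.7,
  9.2, 10.10.
* [Yanai1985] H. Yanai, Nagoya Math. J. 97 (1985), §4 Theorem; [Ribet1980] K. Ribet, §3 (3.7).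
-/

noncomputable section

open CategoryTheory CategoryTheory.Limits NumberField NumberField.ComplexEmbedding IntermediateField Module
open scoped BigOperators

namespace Summit.HodgeConjecture.CorCM

open Literature.NumberTheory.ComplexMultiplication
open Literature.AlgebraicGeometry.Motives (AbelianVariety CMType)
open Literature.AlgebraicGeometry.Motives.AbelianVariety
open Literature.AlgebraicGeometry.HodgeTheory
open Literature.AlgebraicGeometry.ComplexMultiplication (IsCMTypeRealisation isSimple_iff_isPrimitive)
open Literature.AlgebraicGeometry.VanGeemen1994 (hodgeClassSpan)
open Literature.AlgebraicGeometry.Pohlmann1968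
open Literature.Barriers.HodgeConjecture (divisorClassesSpan)

section Criterion

variable {I : Type} {K : I → Type} [∀ i, Field (K i)] [∀ i, NumberField (K i)] [∀ i, IsCMField (K i)] [Fintype I]
  [DecidableEq I] [Nonempty I] {Φ : ∀ i, CMType (K i)}
variable {A : I → AbelianVariety ℂ} {ι : ∀ i, 𝓞 (K i) →+* End (A i)}
  {θ : ∀ i, K i →+* Module.End ℂ (complexBetti (A i).X 1)}

/-- **MAIN CRITERION (Moonen–Zarhin (0.2), CM case, on CM types).**  Let `A_i` (`i ∈ I`) be SIMPLE, PAIRWISE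
NON-ISOGENOUS complex abelian varieties with complex multiplication — realisations of CM types `(K_i; Φ_i)` on `H¹` —
of total dimension `Σ_i dim A_i ≤ 5`.  Then the family `(Φ_i)_i` is nondegenerate (`rank Hg(∏_i A_i) = Σ_i dim A_i`)
iff (¬a⁺) for all slots `a ≠ b` with `dim A_a = 1` and `dim A_b ∈ {3, 4}` the imaginary quadratic field `K_a` does NOT
embed in `K_b`, and (¬b) for every slot with `dim A_b = 4` the type `Φ_b` is nondegenerate.  Proof by the dimension
multiset: all curves; one slot of dimension `≥ 2` and curves (seat b16 gen 37's single-big-slot criterion; dimension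
`2`: Ribet and no embedded quadratic field; `3`: Ribet; `4`: as stated; `5`: Yanai, alone); two slots of dimensions
`(2,3)` (always nondegenerate, SURF-T3) or `(2,2)` with at most one curve (file F4).
[cite: MoonenZarhin1999LowDim, Thm. (0.2) (1)–(4) and §5] [cite: Gordon1999HodgeAVSurvey, 7.4–7.5]
[cite: Yanai1985, §4 Theorem] [cite: Ribet1980, §3 (3.7)] -/
theorem isNondegenerateFamily_iff_of_isSimple_of_sum_dim_le_five
    (hA : ∀ i, IsCMTypeRealisation (Φ i) (A i) (ι i) (θ i)) (hs : ∀ i, (A i).IsSimple)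
    (hniso : ∀ i j, i ≠ j → ¬ AbelianVariety.IsIsogenous (A i) (A j)) (h5 : ∑ i, (A i).dim ≤ 5) :
    CMAlgebra.IsNondegenerateFamily Φ ↔
      (∀ a b, a ≠ b → (A a).dim = 1 → ((A b).dim = 3 ∨ (A b).dim = 4) → IsEmpty (K a →+* K b)) ∧
        ∀ b, (A b).dim = 4 → IsNondegenerate (Φ b) := by
  classical
  have hsep := CMAlgebra.isSeparatingFamily_of_isSimple_of_pairwise_not_isIsogenous hA hs hniso
  have hdeg : ∀ i, finrank ℚ (K i) = 2 * (A i).dim := finrank_eq_two_mul_dim hA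
  have hpos : ∀ i, 0 < (A i).dim := fun i => by
    have h := Module.finrank_pos (R := ℚ) (M := K i)
    rw [hdeg i] at h
    omega
  have hle : ∀ i, (A i).dim ≤ ∑ j, (A j).dim := fun i =>
    Finset.single_le_sum (fun j _ => Nat.zero_le ((A j).dim)) (Finset.mem_univ i)
  -- bookkeeping: two, resp. three, distinct slots have total dimension at most the sum
  have hsum2 : ∀ {i j : I}, i ≠ j → (A i).dim + (A j).dim ≤ ∑ k, (A k).dim := by
    intro i j h
    have h1 := Finset.add_sum_erase Finset.univ (fun k => (A k).dim) (Finset.mem_univ i)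
    have h2 : (A j).dim ≤ ∑ k ∈ Finset.univ.erase i, (A k).dim :=
      Finset.single_le_sum (fun k _ => Nat.zero_le ((A k).dim)) (Finset.mem_erase.2 ⟨h.symm, Finset.mem_univ j⟩)
    omega
  have hsum3 : ∀ {i j l : I}, i ≠ j → i ≠ l → j ≠ l → (A i).dim + (A j).dim + (A l).dim ≤ ∑ k, (A k).dim := by
    intro i j l hij hil hjl
    have h1 := Finset.add_sum_erase Finset.univ (fun k => (A k).dim) (Finset.mem_univ i)
    have h2 := Finset.add_sum_erase (Finset.univ.erase i) (fun k => (A k).dim)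
      (Finset.mem_erase.2 ⟨hij.symm, Finset.mem_univ j⟩)
    have h3 : (A l).dim ≤ ∑ k ∈ (Finset.univ.erase i).erase j, (A k).dim :=
      Finset.single_le_sum (fun k _ => Nat.zero_le ((A k).dim))
        (Finset.mem_erase.2 ⟨hjl.symm, Finset.mem_erase.2 ⟨hil.symm, Finset.mem_univ l⟩⟩)
    omega
  by_cases hall : ∀ i, (A i).dim = 1
  · -- all slots are CM elliptic curves with pairwise non-isomorphic fields
    have h2 : ∀ i, finrank ℚ (K i) = 2 := fun i => by rw [hdeg, hall]
    exact ⟨fun _ => ⟨fun a b _ _ hb => by have := hall b; omega, fun b hb => by have := hall b; omega⟩,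
      fun _ => isNondegenerateFamily_of_finrank_eq_two h2 hsep⟩
  push Not at hall
  obtain ⟨i₁, hi₁⟩ := hall
  have hi₁2 : 2 ≤ (A i₁).dim := by have := hpos i₁; omega
  obtain ⟨φ₁⟩ : Nonempty (K i₁ →+* ℂ) := inferInstance
  have hprim₁ : IsPrimitive (ℂ ≃+* ℂ) (Φ i₁).1 φ₁ := hsep.isPrimitive i₁ φ₁
  by_cases huniq : ∀ j, j ≠ i₁ → (A j).dim = 1
  · -- `i₁` is the only slot of dimension `≥ 2`
    have h2 : ∀ j, j ≠ i₁ → finrank ℚ (K j) = 2 := fun j hj => by rw [hdeg, huniq j hj]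
    have hχ := exists_not_iff_of_isSeparatingFamily (fun i => i = i₁) Φ h2
      (isSeparatingFamily_subtype hsep fun j => j ≠ i₁)
    rw [isNondegenerateFamily_iff_forall_isEmpty_single i₁ Φ h2 hχ]
    -- off `i₁` the dimension-`3`/`4` clause is void
    have hoff : ∀ b, b ≠ i₁ → ¬ ((A b).dim = 3 ∨ (A b).dim = 4) := fun b hb h => by have := huniq b hb; omega
    have hoff4 : ∀ b, b ≠ i₁ → (A b).dim ≠ 4 := fun b hb h => by have := huniq b hb; omega
    rcases (show (A i₁).dim = 2 ∨ (A i₁).dim = 3 ∨ (A i₁).dim = 4 ∨ (A i₁).dim = 5 by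
        have := hle i₁; omega) with hd | hd | hd | hd
    · -- a quartic slot and curves: both sides hold
      have h4K : finrank ℚ (K i₁) = 4 := by rw [hdeg, hd]
      have hnd : IsNondegenerate (Φ i₁) := isNondegenerate_of_isPrimitive_of_finrank_le_six (Φ i₁) (by omega) φ₁ hprim₁
      have hemp : ∀ a, a ≠ i₁ → IsEmpty (K a →+* K i₁) := fun a ha =>
        isEmpty_ringHom_of_finrank_eq_two_of_isPrimitive_quartic Φ (h2 a ha) h4K hprim₁
      refine ⟨fun _ => ⟨fun a b _ _ hb => ?_, fun b hb => ?_⟩, fun _ => ⟨hnd, hemp⟩⟩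
      · exfalso
        by_cases hb1 : b = i₁
        · rw [hb1] at hb; omega
        · exact hoff b hb1 hb
      · exfalso
        by_cases hb1 : b = i₁
        · rw [hb1] at hb; omega
        · exact hoff4 b hb1 hb
    · -- a sextic slot and curves
      have hnd : IsNondegenerate (Φ i₁) :=
        isNondegenerate_of_isPrimitive_of_finrank_le_six (Φ i₁) (by rw [hdeg, hd]) φ₁ hprim₁
      refine ⟨fun h => ⟨fun a b hab _ hb => ?_, fun b hb => ?_⟩,
        fun h => ⟨hnd, fun a ha => h.1 a i₁ ha (huniq a ha) (Or.inl hd)⟩⟩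
      · have hb1 : b = i₁ := by
          by_contra hb1
          exact hoff b hb1 hb
        subst hb1
        exact h.2 a hab
      · exfalso
        by_cases hb1 : b = i₁
        · rw [hb1] at hb; omega
        · exact hoff4 b hb1 hb
    · -- an octic slot and (at most one) curve
      refine ⟨fun h => ⟨fun a b hab _ hb => ?_, fun b hb => ?_⟩,
        fun h => ⟨h.2 i₁ hd, fun a ha => h.1 a i₁ ha (huniq a ha) (Or.inr hd)⟩⟩
      · have hb1 : b = i₁ := by
          by_contra hb1
          exact hoff b hb1 hb
        subst hb1
        exact h.2 a hab
      · have hb1 : b = i₁ := by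
          by_contra hb1
          exact hoff4 b hb1 hb
        subst hb1
        exact h.1
    · -- a slot of dimension `5` (degree `10`, Yanai): it is alone
      have hsub : ∀ j, j = i₁ := fun j => by
        by_contra hj
        have h₁ := hsum2 hj
        have h₂ := huniq j hj
        omega
      have hnd : IsNondegenerate (Φ i₁) :=
        isNondegenerate_of_isPrimitive_of_prime (by norm_num : Nat.Prime 5) (by rw [hdeg, hd]) φ₁ hprim₁
      refine ⟨fun _ => ⟨fun a b hab _ _ => (hab ((hsub a).trans (hsub b).symm)).elim, fun b hb => ?_⟩,
        fun _ => ⟨hnd, fun a ha => (ha (hsub a)).elim⟩⟩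
      obtain rfl := hsub b
      omega
  · -- a second slot `i₀ ≠ i₁` of dimension `≥ 2`; every further slot is a curve
    push Not at huniq
    obtain ⟨i₀, hi₀, hi₀1⟩ := huniq
    have hi₀2 : 2 ≤ (A i₀).dim := by have := hpos i₀; omega
    have h01 := hsum2 hi₀
    have hrest : ∀ j, j ≠ i₀ → j ≠ i₁ → (A j).dim = 1 := fun j hj₀ hj₁ => by
      have h₃ := hsum3 hj₀ hj₁ hi₀
      have := hpos j
      omega
    -- the right-hand side is void: no slot of dimension `3` or `4` next to a curve… unless `(2,3)` without curves
    by_cases h23 : (A i₀).dim + (A i₁).dim = 5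
    · -- dimensions `(2,3)` or `(3,2)`: no curve fits; SURF-T3
      have hI : ∀ j, j = i₀ ∨ j = i₁ := fun j => by
        by_contra hj
        push Not at hj
        have h₃ := hsum3 hj.1 hj.2 hi₀
        have := hpos j
        omega
      have hnd : CMAlgebra.IsNondegenerateFamily Φ := by
        rcases (show (A i₀).dim = 2 ∨ (A i₁).dim = 2 by omega) with hd | hd
        · exact isNondegenerateFamily_simpleSurface_simpleThreefold hi₀ hI (by rw [hdeg, hd]) (by rw [hdeg]; omega)
            hA (hs i₀) (hs i₁)
        · exact isNondegenerateFamily_simpleSurface_simpleThreefold (Ne.symm hi₀) (fun j => (hI j).symm)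
            (by rw [hdeg, hd]) (by rw [hdeg]; omega) hA (hs i₁) (hs i₀)
      refine ⟨fun _ => ⟨fun a b _ ha _ => ?_, fun b hb => ?_⟩, fun _ => hnd⟩
      · exfalso; rcases hI a with rfl | rfl <;> omega
      · exfalso; rcases hI b with rfl | rfl <;> omega
    · -- dimensions `(2,2)` and at most one curve: file F4
      have hd₀ : (A i₀).dim = 2 := by omega
      have hd₁ : (A i₁).dim = 2 := by omega
      let p : I → Prop := fun i => i = i₀ ∨ i = i₁
      have h2 : ∀ j, ¬p j → finrank ℚ (K j) = 2 := fun j hj => by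
        have hj' : j ≠ i₀ ∧ j ≠ i₁ := not_or.1 hj
        rw [hdeg, hrest j hj'.1 hj'.2]
      have hnd : CMAlgebra.IsNondegenerateFamily Φ :=
        isNondegenerateFamily_curves_simpleSurfaces p hi₀ (fun _ => Iff.rfl) (by rw [hdeg, hd₀]) (by rw [hdeg, hd₁])
          h2 hA (hs i₀) (hs i₁) (hniso i₀ i₁ hi₀) (isSeparatingFamily_subtype hsep fun j => ¬p j)
      refine ⟨fun _ => ⟨fun a b _ _ hb => ?_, fun b hb => ?_⟩, fun _ => hnd⟩
      · exfalso
        by_cases hb₀ : b = i₀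
        · rw [hb₀] at hb; omega
        by_cases hb₁ : b = i₁
        · rw [hb₁] at hb; omega
        have := hrest b hb₀ hb₁; omega
      · exfalso
        by_cases hb₀ : b = i₀
        · rw [hb₀] at hb; omega
        by_cases hb₁ : b = i₁
        · rw [hb₁] at hb; omega
        have := hrest b hb₀ hb₁; omega

end Criterion

/-! ## Hodge classes on the products -/

section Geometry

variable {I : Type} {K : I → Type} [∀ i, Field (K i)] [∀ i, NumberField (K i)] [∀ i, IsCMField (K i)] [Fintype I]
  [DecidableEq I] [Nonempty I] {Φ : ∀ i, CMType (K i)}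
variable {A : I → AbelianVariety ℂ} {ι : ∀ i, 𝓞 (K i) →+* End (A i)}
  {θ : ∀ i, K i →+* Module.End ℂ (complexBetti (A i).X 1)}

/-- **`Bᵐ ⊗ ℂ = Dᵐ ⊗ ℂ` on every `∏_i A_i^{k_i}`** for simple, pairwise non-isogenous CM abelian varieties of total
dimension `≤ 5` satisfying (¬a⁺) ∧ (¬b) (Moonen–Zarhin (0.2) (4), CM case). [cite: MoonenZarhin1999LowDim, Thm. (0.2) (4)]
[cite: Gordon1999HodgeAVSurvey, 7.5] -/
theorem hodgeClassSpan_prod_eq_divisorClassesSpan_of_sum_dim_le_five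
    (hA : ∀ i, IsCMTypeRealisation (Φ i) (A i) (ι i) (θ i)) (hs : ∀ i, (A i).IsSimple)
    (hniso : ∀ i j, i ≠ j → ¬ AbelianVariety.IsIsogenous (A i) (A j)) (h5 : ∑ i, (A i).dim ≤ 5)
    (hfor : ∀ a b, a ≠ b → (A a).dim = 1 → ((A b).dim = 3 ∨ (A b).dim = 4) → IsEmpty (K a →+* K b))
    (hoct : ∀ b, (A b).dim = 4 → IsNondegenerate (Φ b)) {N : ℕ} (π : Fin N → I) (m : ℕ) :
    hodgeClassSpan (⨁ fun j : Fin N => A (π j)).dim (⨁ fun j : Fin N => A (π j)).X m =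
      divisorClassesSpan (⨁ fun j : Fin N => A (π j)).X (⨁ fun j : Fin N => A (π j)).dim m :=
  ((isNondegenerateFamily_iff_of_isSimple_of_sum_dim_le_five hA hs hniso h5).2 ⟨hfor, hoct⟩)
    |>.hodgeClassSpan_prod_eq_divisorClassesSpan hA π m

/-- **The Hodge conjecture for every `∏_i A_i^{k_i}`** (every `⨁_{j<N} A_{π j}`) of SIMPLE, PAIRWISE NON-ISOGENOUS
complex abelian varieties with complex multiplication of total dimension `≤ 5` such that no curve field embeds in the
field of a threefold or fourfold member and a fourfold member has a nondegenerate type — UNCONDITIONALLY (e.g.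
`S × T`, `E × S × S′`, `E × E′ × T` with `k, k′ ↪̸ K_T`, `E × F` with `F` a nondegenerate simple CM fourfold and
`k ↪̸ K_F`, a simple CM fivefold, and all products of their powers). [cite: MoonenZarhin1999LowDim, Thm. (0.2) (4)]
[cite: Gordon1999HodgeAVSurvey, 7.5 and 10.10] -/
theorem hodgeConjectureFor_prod_of_sum_dim_le_five
    (hA : ∀ i, IsCMTypeRealisation (Φ i) (A i) (ι i) (θ i)) (hs : ∀ i, (A i).IsSimple)
    (hniso : ∀ i j, i ≠ j → ¬ AbelianVariety.IsIsogenous (A i) (A j)) (h5 : ∑ i, (A i).dim ≤ 5)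
    (hfor : ∀ a b, a ≠ b → (A a).dim = 1 → ((A b).dim = 3 ∨ (A b).dim = 4) → IsEmpty (K a →+* K b))
    (hoct : ∀ b, (A b).dim = 4 → IsNondegenerate (Φ b)) {N : ℕ} (π : Fin N → I) :
    HodgeConjectureFor (⨁ fun j : Fin N => A (π j)).dim (⨁ fun j : Fin N => A (π j)).X :=
  ((isNondegenerateFamily_iff_of_isSimple_of_sum_dim_le_five hA hs hniso h5).2 ⟨hfor, hoct⟩)
    |>.hodgeConjectureFor_prod hA π

/-- **`B• = D•` on EVERY product iff (¬a⁺) ∧ (¬b)**, total dimension `≤ 5`. [cite: MoonenZarhin1999LowDim, Thm. (0.2) (1)–(4)]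
[cite: Gordon1999HodgeAVSurvey, 7.5–7.6] -/
theorem forall_prod_hodgeClassSpan_eq_iff_of_sum_dim_le_five
    (hA : ∀ i, IsCMTypeRealisation (Φ i) (A i) (ι i) (θ i)) (hs : ∀ i, (A i).IsSimple)
    (hniso : ∀ i j, i ≠ j → ¬ AbelianVariety.IsIsogenous (A i) (A j)) (h5 : ∑ i, (A i).dim ≤ 5) :
    (∀ (N : ℕ) (π : Fin N → I) (m : ℕ),
        hodgeClassSpan (⨁ fun j : Fin N => A (π j)).dim (⨁ fun j : Fin N => A (π j)).X m =
          divisorClassesSpan (⨁ fun j : Fin N => A (π j)).X (⨁ fun j : Fin N => A (π j)).dim m) ↔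
      (∀ a b, a ≠ b → (A a).dim = 1 → ((A b).dim = 3 ∨ (A b).dim = 4) → IsEmpty (K a →+* K b)) ∧
        ∀ b, (A b).dim = 4 → IsNondegenerate (Φ b) := by
  rw [← CMAlgebra.isNondegenerateFamily_iff_forall_prod_hodgeClassSpan_eq
    (CMAlgebra.isSeparatingFamily_of_isSimple_of_pairwise_not_isIsogenous hA hs hniso) hA]
  exact isNondegenerateFamily_iff_of_isSimple_of_sum_dim_le_five hA hs hniso h5

/-- **An exotic Hodge class on SOME product `∏_i A_i^{k_i}` iff (a⁺) ∨ (b)**, total dimension `≤ 5` (Hazama–Murty for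
the degenerate family: Moonen–Zarhin's cases (e), (f), (g) and the degenerate simple fourfold factor).
[cite: MoonenZarhin1999LowDim, Thm. (0.2) (1)–(4)] [cite: Gordon1999HodgeAVSurvey, 7.5 and 9.2] -/
theorem exists_exceptional_prod_iff_of_sum_dim_le_five
    (hA : ∀ i, IsCMTypeRealisation (Φ i) (A i) (ι i) (θ i)) (hs : ∀ i, (A i).IsSimple)
    (hniso : ∀ i j, i ≠ j → ¬ AbelianVariety.IsIsogenous (A i) (A j)) (h5 : ∑ i, (A i).dim ≤ 5) :
    (∃ (N : ℕ) (π : Fin N → I) (m : ℕ) (c : complexBetti (⨁ fun j : Fin N => A (π j)).X (2 * m)),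
        IsRationalClass c ∧
          IsOfHodgeType (⨁ fun j : Fin N => A (π j)).dim (⨁ fun j : Fin N => A (π j)).X (2 * m) m m c ∧
          c ∉ divisorClassesSpan (⨁ fun j : Fin N => A (π j)).X (⨁ fun j : Fin N => A (π j)).dim m) ↔
      ¬((∀ a b, a ≠ b → (A a).dim = 1 → ((A b).dim = 3 ∨ (A b).dim = 4) → IsEmpty (K a →+* K b)) ∧
          ∀ b, (A b).dim = 4 → IsNondegenerate (Φ b)) := by
  rw [← isNondegenerateFamily_iff_of_isSimple_of_sum_dim_le_five hA hs hniso h5]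
  refine ⟨fun ⟨N, π, m, c, hcQ, hcH, hcD⟩ hnd => (hnd.not_exists_exceptional_prod hA π m) ⟨c, hcQ, hcH, hcD⟩,
    fun hnd => ?_⟩
  exact CMAlgebra.exists_exceptional_prod_of_not_isNondegenerateFamily
    (CMAlgebra.isSeparatingFamily_of_isSimple_of_pairwise_not_isIsogenous hA hs hniso) hnd hA

end Geometry

end Summit.HodgeConjecture.CorCM

end
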